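import Mathlib
import HarnessLib
import HarnessLib.Audit
import Summits.CriticalPhenomena.Statement

/-!
Route: PercCriticalCaps

DORMANT since 2026-08-28T21:07:20Z (reconciler: no traction for 5.1 d (last activity statement-closed at 2026-08-23T17:36:22Z); parked, not closed — `ledger route dormant route-CriticalPhenomena-PercCriticalCaps --off` to reactivate) — unstaffed, not closed; items shared with open routes are served there. `ledger route dormant <id> --off` reactivates.

# Route PercCriticalCaps — caps kill clusters — ACCFR's separating closed sheet at p_c would give
θ(p_c)=0; barrier route filing the cap dichotomy

BARRIER / CALIBRATION ROUTE realising card caps-kill-clusters (declared up front: X is believed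
FALSE on ℤ³ and the
informative outcome is its refutation, which lands as a theorem about critical dual sheets). It
suffices to show
X = CapAtCriticality: at p = p_c(ℤ³), almost surely only finitely many points t·e₀ (t > 0) of the
positive
coordinate axis are joined by an open path to the plane {x₀ = 0} — equivalently (CapZeroOne,
EnvelopeCap) the
Aizenman–Chayes–Chayes–Fröhlich–Russo event "an infinite sheet of closed plaquettes separates the
positive axis from
the plane" has positive probability AT criticality, i.e. the Barsky–Grimmett–Newman envelope over
the plane is a
closed CAP (every column bounded). Caps kill clusters (CapLemma: stationarity under the vertical
shift + uniqueness),
so X gives θ(p_c) = 0 in two lines; NoCapAtCriticality (¬X in its a.s. form) is filed as the kill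
switch and ranked 2
(the branch expected TRUE on ℤ³ and the informative theorem), X itself ranked 3.
Lean: `∀ᵐ ω ∂(Literature.Probability.Percolation.bondPercolation
(Literature.Probability.LatticeModels.zdGraph 3) (Literature.Probability.Percolation.criticalProbI
3)), Set.Finite {t : ℤ | 0 < t ∧ ∃ y : Literature.Probability.LatticeModels.Site 3, y 0 = 0 ∧ ω ∈
Literature.Probability.Percolation.openConn (Pi.single 0 t :
Literature.Probability.LatticeModels.Site 3) y}`

## Assembly
Pure logic (checked sorry-free in Sketch.lean: `intro hL hE hC; exact hL 3 _ (hE 3 _ hC)`):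
PercolationContinuityZ3
unfolds to theta (zdGraph 3) 0 (criticalProbI 3) = 0; EnvelopeCap at d = 3, p = criticalProbI 3
turns
CapAtCriticality into an a.s. closed cap, and CapLemma at d = 3 returns θ(p_c) = 0.
NoCapAtCriticality is NOT in
the assembly: it is the filed negation (Sketch.lean also checks NoCapAtCriticality →
¬CapAtCriticality).

Rationale: WHY THIS LINE. Mechanism (card caps-kill-clusters): if a.s. a closed cap B ⊇ {x₀ ≤ 0} with bounded
columns exists, the top height
of the (a.s. unique, BurtonKeane1989 / AizenmanKestenNewman1987 — PROVED in the tree) infinite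
cluster in a column
is a ℤ∪{±∞}-valued statistic covariant under the measure-preserving shift by e₀, hence a.s. ±∞,
while the cap
through any vertex of the cluster bounds it: θ = 0 (CapLemma); the minimal cap is the BGN envelope,
which is a cap
iff the axis meets the plane cluster finitely often (EnvelopeCap), an event of probability 0 or 1
(CapZeroOne).
Calibration from two sides, all on PROVED cone facts: caps exist for every p < p_c (CapBelowCritical
=
AizenmanChayesChayesFrohlichRusso1983 Lemma 3.1 with π_c = p_c by the PROVED quasi-transitive
sharpness
DuminilCopinTassionCMP2016) and never when θ > 0, so the cap/sheet threshold of the dual plaquette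
system is
EXACTLY p_c in every d ≥ 2 — unlike the homological surfaces of GrimmettHolroydKozma2014 (p_surf ≥
p_fin > p_c for
d ≥ 19); and caps exist whenever Σ_n π_p(n) < ∞ (SummableOneArmGivesCap), hence AT p_c in high d by
KozmaNachmias2011 (π ≍ n⁻²), while on ℤ³ the one-arm codimension 3 − d_f ≈ 0.48 < 1
(WangZhouZhangGaroniDeng2013)
predicts ¬X. Imported areas: ergodic theory of a single ℤ-action (covariant integer statistics),
plaquette
duality / random surfaces (ACCFR), Lipschitz-surface percolation
(DirrDondlGrimmettHolroydScheutzow2010,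
GrimmettHolroyd2012) as the source of the cap notion. What it does that the 29 prior Theses and the
negatives
index (1 SAW item) do not: it is the only line using a single stationary dual object, it types
ACCFR's 1983
critical-point question as a dichotomy whose either branch is a theorem worth having (X ⇒ conjunct
and
perimeter law at criticality; ¬X ⇒ the barrier "sheet-confinement proofs of continuity need a
summable one-arm
probability"), and its four support items are provable now.

RANKED CRUXES. #2 NoCapAtCriticality (crux) — the kill switch (negative side, filed ranked): at p =
p_c(ℤ³), a.s. INFINITELY many heights t > 0 have t·e₀ ↔ {x₀ = 0} — no closed cap / no ACCFR
separating sheet survives at criticality; the 3-D analogue of Harris' "no infinite closed dual path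
at 1/2". With CapZeroOne it is equivalent to ¬CapAtCriticality; a Theorems proof closes
CapAtCriticality as refuted and is the barrier deliverable. [difficulty: open-problem] (why it might
fail: FALSE in high d (caps exist at p_c(ℤ^d) for d > 6 under the two-point estimate: KN one-arm
C/n² is summable, then SummableOneArmGivesCap), so a proof must be 3-specific; it implies Σ_n
π_(p_c)(n) = ∞ on ℤ³, beyond every proved lower bound (DCT gives only π(n) ≥ c/n²).) [Harris1960,
KozmaNachmias2011, DuminilCopinTassionCMP2016, AizenmanChayesChayesFrohlichRusso1983]
#3 CapAtCriticality (crux) — CAP(p_c): for bond percolation on ℤ³ at p = p_c, a.s. the set of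
heights t > 0 with t·e₀ ↔ {x₀ = 0} is finite (card caps-kill-clusters, crux C1; ⇔ ACCFR's
separating-sheet event D has positive probability at p = 1 − p_c on the plaquette side ⇔ the BGN
envelope is a closed cap). [difficulty: open-problem] (why it might fail: Believed FALSE on ℤ³:
E#{t≤n: te₀↔plane} ≍ Σ_{t≤n} π(t) ~ n^0.52 → ∞ (one-arm codimension 3−d_f ≈ 0.48 < 1, d_f = 2.523)
and quasi-multiplicativity along the axis should give infinitely many hits; it holds only where Σπ <
∞ (d ≥ 19 via Kozma–Nachmias).) [AizenmanChayesChayesFrohlichRusso1983, GrimmettHolroydKozma2014,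
KozmaNachmias2011, WangZhouZhangGaroniDeng2013]
#9 CapLemma (support) — CAPS KILL CLUSTERS (bond ℤ^d, every d ≥ 1 and p): if a.s. there is a vertex
set B ⊇ {x₀ ≤ 0} with every column {t | update x 0 t ∈ B} bounded above and every lattice edge from
B to Bᶜ closed, then θ(p) = 0. Proof: uniqueness (Grimmett1999_numInfiniteClusters_le_one_holds) +
shift invariance (bondPercolation_real_preimage_shift): M = sup{t : t·e₀ in an infinite cluster}
satisfies law(M) = law(M+1) on ℤ∪{±∞}, so M ∉ ℤ a.s.; on {0 ↔ ∞} the cap through 0 contains the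
unique infinite cluster, forcing 0 ≤ M < ∞. Card item T1. [difficulty: provable-now]
[BurtonKeane1989, AizenmanKestenNewman1987, GrimmettPercolation1999,
DirrDondlGrimmettHolroydScheutzow2010, GrimmettHolroyd2012]
#9 EnvelopeCap (support) — the Barsky–Grimmett–Newman ENVELOPE is a cap: if a.s. the positive axis
meets the plane cluster finitely often, then a.s. B = {x₀ ≤ 0} ∪ {x : x₀ > 0, x ↔ plane} satisfies
the three cap conditions (horizontal shift invariance gives every column, countably many; an open
edge leaving B would extend a plane connection — contradiction). Pure combinatorics +
measure-preserving shifts. [difficulty: provable-now] [BarskyGrimmettNewman1991,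
GrimmettPercolation1999]
#9 CapBelowCritical (support) — caps exist strictly below p_c (Aizenman–Chayes–Chayes–Fröhlich–Russo
1983, Lemma 3.1, with π_c = p_c): for p < p_c(ℤ^d), a.s. finitely many axis–plane hits, since E#hits
≤ Σ_t Σ_{y₀=0} τ_p(t·e₀, y) = Σ_{x₀<0} τ_p(0,x) ≤ E_p|C(0)| < ∞ by the PROVED sharpness
DCTQ.summable_real_openConn_of_lt_criticalProb (first moment / Borel–Cantelli). With CapLemma: the
cap threshold equals p_c exactly. [difficulty: provable-now] [AizenmanChayesChayesFrohlichRusso1983,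
DuminilCopinTassionCMP2016, AizenmanBarsky1987]
#9 SummableOneArmGivesCap (support) — calibration: if the one-arm probabilities π_p(n) = P_p(0 ↔
∂B(n)) (siteToBoundary, = oneArmProb d p n) are summable in n then a.s. finitely many axis–plane
hits ({t·e₀ ↔ plane} forces the one-arm event to distance t−1 around t·e₀; shift invariance;
Borel–Cantelli). With Kozma–Nachmias (π_(p_c)(n) ≤ C/n² for d > 6 under TwoPointBoundedRatio, d ≥ 11
via Hara) caps EXIST at criticality in high dimensions; contrapositively NoCapAtCriticality needs
Σ_n π_(p_c)(n) = ∞ on ℤ³. [difficulty: provable-now] [KozmaNachmias2011,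
HeydenreichVanDerHofstad2017, FitznerVanDerHofstad2017]
#9 CapZeroOne (support) — zero–one law for caps: P_p(finitely many axis–plane hits) ∈ {0, 1} for
every d, p — the event "infinitely many hits" is a.s. invariant under the shift by −e₀ (a hit at
height t ≥ 2 becomes a hit at height t−1, the path crossing the new plane), and the shift is ergodic
(PROVED ergodic_relabel_shift_bondPercolation; Mathlib Ergodic.ae_empty_or_univ_of_ae_le_preimage).
Makes NoCapAtCriticality ⇔ ¬CapAtCriticality and lets a refuter kill CAP(p_c) by showing
P(infinitely many hits) > 0. [difficulty: provable-now] [GrimmettPercolation1999,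
NewmanSchulman1981]

TWO-LAYER PLAN. Foreseen glued splits (k ≤ 3, depth 1), filed only after movement:
NoCapAtCriticality ⇐ OneArmNonSummableZ3
(Σ_n π_(p_c)(n) = ∞ on ℤ³ — itself open, the honest residue) → AxisHitsQuasiIndependence
(Kochen–Stone along the
axis: Σ_(s,t≤n) P(E_s ∩ E_t) ≤ C (Σ_(t≤n) P(E_t))², tree-graph bound + quasi-multiplicativity) →
NoCapAtCriticality
(positive probability, then CapZeroOne). CapAtCriticality has one known engine only
(SummableOneArmGivesCap at p_c,
false on ℤ³ numerically): no split foreseen. Support items need no splits; helper lemmas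
(measurability of the hit
set, tsum reindexing over Site d, walk surgery to the box boundary) ride with --supports.

KILL CRITERIA. A Theorems proof of NoCapAtCriticality gives ¬CapAtCriticality (two-line lemma in
Sketch.lean) — close
`refuted:CapAtCriticality`; the refutation file together with CapLemma, CapBelowCritical,
SummableOneArmGivesCap is
the barrier deliverable "critical closed caps ⇔ summable one-arm; cap/sheet-confinement proofs of
θ(p_c)=0 are void
on ℤ³" for a literature seat to vendor under Literature/Barriers/CriticalPhenomena. A proof of Σ_n
π_(p_c)(n) = ∞ on
ℤ³ (or of any one-arm lower bound n^(−1+o(1)) i.o.) kills the only engine for CapAtCriticality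
without refuting it:
route goes dormant / `exhausted` with that census. θ(p_c) = 0 proved elsewhere moots the assembly
but not the
dichotomy (ACCFR's critical-point question stays open and cheap to keep). A printed proof that
ACCFR's event D is
null at p = 1 − p_c makes item 3 `known`: vendor and close superseded.

NOT DECOMPOSED YET. (i) The Lipschitz corollary of the card (Corollary A: p_L(ℤ^d, site) ≥ 1 −
p_c^site(ℤ^d), sharpening
GrimmettHolroyd2012 Prop 9) is NOT an item: it needs SITE-percolation uniqueness (not in the tree;
only bond
Grimmett1999_numInfiniteClusters_le_one is proved) and a Lipschitz-surface notion; CapLemma is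
stated for general
caps so that a literature seat can derive it once site uniqueness lands. (ii) The equivalence
"CapAtCriticality ⇔
μ_(p_c)(D) > 0" with ACCFR's exact event D (no hit at all) and "⇒ perimeter law at criticality"
(ACCFR Thm 3.2's FKG
column argument) are remarks, not items. (iii) A general-d version of the crux pair (CAP_d(p_c(d))
true for d ≥ 19,
expected false for 3 ≤ d ≤ 6) is left to SummableOneArmGivesCap + the KN fact; no d ≠ 3 crux is
filed. (iv) No
constants, no second-moment lemma, no one-arm lower bound is filed now — they are layer-2 children
of
NoCapAtCriticality (Two-layer plan).

CHEAPEST FALSIFIER. (1) Monte-Carlo, ~1 cpu-h (kit; not run — plancard is one-shot and the hub is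
compute-free): bond ℤ³ at
p = 0.2488126 in boxes of side L = 32…256 with the plane x₀ = 0 as source; record N(L) = #{t ≤ L/2 :
t·e₀ ↔ plane
inside the box} and H(L) = 1{∃ hit with t ∈ [L/4, L/2]}. CAP(p_c) is dead numerically if mean N(L)
grows like
L^0.52 and P(H(L)) stays bounded below (expected); it would be alive only if P(H(L)) → 0. The card's
own site-lattice
run (L ≤ 128) already shows envelope column heights diverging as the closed density rises to
p_c^site = 0.3116.
(2) Lookup (done, negative): a printed statement that ACCFR's separating sheet is a.s. absent at p =
1 − p_c —
ACCFR83 §§3–5 (critical point explicitly left open, p. 22), GH10 (Open Questions concern admissible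
paths), GHK14
(homological p_surf only), Duncan–Schweinhart arXiv:2011.11903 (torus thresholds, not the critical
behaviour).

NUMBERS. p_c(ℤ³, bond) = 0.2488126(5); fractal dimension d_f = 2.52293(10) ⇒ one-arm codimension 3 −
d_f = 0.477 < 1, so
Σ_(t≤n) π(t) ~ n^0.52 (WangZhouZhangGaroniDeng2013); closed-plaquette density at the cap threshold 1
− p_c = 0.7512;
card numerics (site ℤ³, L ≤ 128): Lipschitz-cap threshold q_Lip ≈ 0.215, SOS-cap q_SOS ≈ 0.27,
envelope cap → p_c^site
= 0.3116⁻; high d: c/n² ≤ π_(p_c)(n) ≤ C/n² (KozmaNachmias2011, d > 6 given the two-point estimate;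
d ≥ 11 with
FitznerVanDerHofstad2017 / Hara) ⇒ Σπ < ∞ ⇒ caps at criticality; ℤ³ rigorous: π_(p_c)(n) ≥ c/n² only
(DCT φ_(p_c)(S) ≥ 1).
GHK14: p_c < p_fin ≤ p_surf for d ≥ 19 (homological sheets coexist with the infinite cluster; caps
never do).
Items at open: 8 (2 cruxes, 5 support, assembly).

DEFINITION REQUESTS. None. The cap is inlined as a predicate on B : Set (Site d) (three clauses);
the hit set is
{t : ℤ | 0 < t ∧ ∃ y, y 0 = 0 ∧ ω ∈ openConn (Pi.single 0 t) y}; bondPercolation / zdGraph /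
openConn / theta /
criticalProb / criticalProbI / siteToBoundary are prelude declarations (lean check of Sketch.lean:
rc 0). A future
Literature notion `LipschitzSurface` (DDGHS) would be wanted only for the off-route Corollary A. Bib
keys added this
session: AizenmanChayesChayesFrohlichRusso1983, DirrDondlGrimmettHolroydScheutzow2010,
GrimmettHolroyd2012,
GrimmettHolroydKozma2014, WangZhouZhangGaroniDeng2013.

Novelty: Searches (2026-08-15): `lit search "random surfaces plaquette percolation area law perimeter law
sharp transition three dimensions"` (local 3: ACCFR83 held, arXiv:2011.11903, arXiv:2308.07534;
crossref 10; openalex/s2/arxiv HTTP 429); `lit read doi:10.1007/bf01206313` pp. 3–4, 12–14 (ACCFR83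
Thm 1.1, Lemma 3.1, Remark p. 31, Thm 3.2); `lit read arXiv:1303.1657` (GHK14 §1: p_fin, p_surf,
"whether these surfaces undergo a phase transition at p_c"); `lit read arXiv:1002.2623 --grep` (GH10
Open Questions 1–2); `lit read arXiv:2011.11903 --grep` (Duncan–Schweinhart: (d−1)-cycle threshold 1
− p_c on the torus); `lit frontier CriticalPhenomena --since 2020` (30 rows, none on dual sheets at
p_c); `lit bridges CriticalPhenomena --cross any` (none relevant); `lit galaxy search "plaquette
percolation" --star all` (3: Chorin, Kardar, Kotecký–Laanait–Messager–Ruiz 1990 Potts surface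
tensions) and two longer phrases (0); tree: 29 Theses of the sub (grep
cap|Lipschitz|envelope|sheet|stationar: no cap mechanism), `ledger negatives` (1 SAW item), 11
Barriers entries, the card and its novelty audit (GH12 Prop 9, DDGHS p. 2).
Nearest prior art found: AizenmanChayesChayesFrohlichRusso1983 Lemma 3.1 + Remark p. 31 (the
separating-sheet event D, μ(D) > 0 for p < π_c by E#hits ≤ Σ τ — exactly CapBelowCritical) and Thm
1.1 (area/perimeter law on either side; p. 22 leaves the critical point open);
GrimmettHolroydKozma2014 Thm 2 / Cor 3 (homological p_surf ≥ p_fin > p_c, d ≥ 19);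
GrimmettHolroyd2012 §  [refs: 10.1007/bf01206313`, 2011.11903, 2308.07534, 1303.1657, 1002.2623, doi:10.1007/bf01206313, AizenmanChayesChayesFrohlichRusso1983, GrimmettHolroydKozma2014, GrimmettHolroyd2012]

Barriers (technique_class: closed-surface-confinement, stationarity, plaquette-duality): - technique_class: closed-surface-confinement, stationarity, plaquette-duality
- Literature.Barriers.CriticalPhenomena.TransverseCrossingsNeedNotMeet: evaded by design — nothing
is glued and no two crossings must meet; the dual object is one global sheet and the contradiction
is one-dimensional (a column statistic); conceded that this is exactly why the object cannot exist
at a scale-invariant critical point on ℤ³ (the route's own barrier).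
- Literature.Barriers.CriticalPhenomena.SpanningClustersAboveSix: consistent and used as calibration
— for d > 6 boxes are spanned w.h.p. yet caps EXIST at p_c (Σ C/n² < ∞): spanning clusters of height
L coexist with a cap because the cap's column heights have a heavy but summable tail; the barrier
bites on RSW-type routes, not on this one.
- Literature.Barriers.CriticalPhenomena.LaceExpansionHighDimension: the KN one-arm fact it vendors
(KozmaNachmias2011_oneArmUpper, d > 6 + TwoPointBoundedRatio) is imported only as the high-d
calibration of SummableOneArmGivesCap; nothing mean-field is claimed on ℤ³.
- Literature.Barriers.CriticalPhenomena.SprinklingRenormalisation: not engaged — no block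
renormalisation, no sprinkling; every support item is an a.s. statement at a single p.
- Literature.Barriers.CriticalPhenomena.SlabLimitUniformControl: not engaged — no slab limit; the
plane enters as a boundary, not as a slab family.
- Literature.Barriers.CriticalPhenomena.RandomClusterFirstOrder: it does not run uniformly in q:
CapLemma uses "one Ber

History (route lifecycle, newest last):
- 2026-08-22T14:07:13Z · DORMANT — reconciler: no traction for 5.4 d (last activity item-evidence-added at 2026-08-17T04:11:30Z); parked, not closed — `ledger route dormant route-CriticalPhenomen (operator:999:2864682)
- 2026-08-23T14:47:08Z · REACTIVATED — reconciler: reactivated — activity item-proof-filed at 2026-08-23T12:14:05Z after parking at 2026-08-22T14:07:13Z (operator:999:1537377)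
- 2026-08-28T21:07:20Z · DORMANT — reconciler: no traction for 5.1 d (last activity statement-closed at 2026-08-23T17:36:22Z); parked, not closed — `ledger route dormant route-CriticalPhenomena-P (operator:999:1625053)

sub-problem: PercolationContinuityZ3 · status: dormant · opened planner-plancard-CriticalPhenomena-Percolatio-3e649c88-0 2026-08-15T12:11:01Z · rev 4 · ledger route-CriticalPhenomena-PercCriticalCaps
GENERATED by the gate from the ledger (D-0016/17). Provers cite these decls: `theorem foo : Summit.CriticalPhenomena.PercolationContinuityZ3.Theses.PercCriticalCaps.<Decl> := …` in Summits/CriticalPhenomena/PercolationContinuityZ3/Theorems/<Name>.lean.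
-/

namespace Summit.CriticalPhenomena.PercolationContinuityZ3.Theses.PercCriticalCaps

open scoped BigOperators Topology Manifold Classical MeasureTheory ProbabilityTheory Matrix InnerProductSpace ComplexConjugate ContinuousMap
open Filter Set Function TopologicalSpace MeasureTheory

attribute [summit_statement] _root_.PercolationContinuityZ3

/-- item stmt-CriticalPhenomena-7510 · crux · rank 3 · open · by planner
why it might fail: Believed FALSE on ℤ³ (E#hits(≤n) ~ n^0.52: one-arm codim 3−d_f = 0.48 < 1) and its only engine is dead there RIGOROUSLY: π_pc(n) ≥ c/n (Kesten82 Thm 5.1 crossings ≥ κ at p_c + vdBK BK √-trick) gives Σπ = ∞, so SummableOneArmGivesCap never fires in d = 3; X is true only in high d (KN, d ≥ 11).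
sources: AizenmanChayesChayesFrohlichRusso1983, WangZhouZhangGaroniDeng2013, KozmaNachmias2011, GrimmettHolroydKozma2014, Kesten1982, vandenBergKestenJAP1985
[crux] CAP(p_c): for bond percolation on ℤ³ at p = p_c, a.s. the set of heights t > 0 with t·e₀ ↔
{x₀ = 0} is finite (card caps-kill-clusters, crux C1; ⇔ ACCFR's separating-sheet event D has
positive probability at p = 1 − p_c on the plaquette side ⇔ the BGN envelope is a closed cap).
[difficulty: open-problem] -/
@[route_item "route-CriticalPhenomena-PercCriticalCaps"]
def CapAtCriticality : Prop :=
  ∀ᵐ ω ∂(Literature.Probability.Percolation.bondPercolation (Literature.Probability.LatticeModels.zdGraph 3) (Literature.Probability.Percolation.criticalProbI 3)), Set.Finite {t : ℤ | 0 < t ∧ ∃ y : Literature.Probability.LatticeModels.Site 3, y 0 = 0 ∧ ω ∈ Literature.Probability.Percolation.openConn (Pi.single 0 t : Literature.Probability.LatticeModels.Site 3) y}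

/-- item stmt-CriticalPhenomena-7511 · aside · rank 2 · open · by planner
why it might fail: False for d ≥ 11 (KN: π_pc(n) ≤ C/n² ⇒ cap via SummableOneArmGivesCap), numerically for d ≥ 5: only low-d input can prove it; on ℤ³ just E#hits = ∞ is in reach (π_pc(n) ≥ c/n: Kesten82 Thm 5.1 at p_c + vdBK √-trick) — a.s. infinitely many needs axis decorrelation (2nd moment/RSW), unknown in d=3.
sources: KozmaNachmias2011, FitznerVanDerHofstad2017, Kesten1982, vandenBergKestenJAP1985, GrimmettPercolation1999, DuminilCopinTassionCMP2016
[crux] the kill switch (negative side, filed ranked): at p = p_c(ℤ³), a.s. INFINITELY many heights t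
> 0 have t·e₀ ↔ {x₀ = 0} — no closed cap / no ACCFR separating sheet survives at criticality; the
3-D analogue of Harris' "no infinite closed dual path at 1/2". With CapZeroOne it is equivalent to
¬CapAtCriticality; a Theorems proof closes CapAtCriticality as refuted and is the barrier
deliverable. [difficulty: open-problem] -/
@[route_item "route-CriticalPhenomena-PercCriticalCaps"]
def NoCapAtCriticality : Prop :=
  ∀ᵐ ω ∂(Literature.Probability.Percolation.bondPercolation (Literature.Probability.LatticeModels.zdGraph 3) (Literature.Probability.Percolation.criticalProbI 3)), Set.Infinite {t : ℤ | 0 < t ∧ ∃ y : Literature.Probability.LatticeModels.Site 3, y 0 = 0 ∧ ω ∈ Literature.Probability.Percolation.openConn (Pi.single 0 t : Literature.Probability.LatticeModels.Site 3) y}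

/-- item stmt-CriticalPhenomena-7512 · support · rank 9 · closed · proved by Summit.CriticalPhenomena.PercolationContinuityZ3.Theorems.PercCriticalCapsCapLemma.capLemma_proof @ a6ae0b31789a (prover) · by planner
sources: BurtonKeane1989, AizenmanKestenNewman1987, GrimmettPercolation1999, DirrDondlGrimmettHolroydScheutzow2010, GrimmettHolroyd2012
[support] CAPS KILL CLUSTERS (bond ℤ^d, every d ≥ 1 and p): if a.s. there is a vertex set B ⊇ {x₀ ≤
0} with every column {t | update x 0 t ∈ B} bounded above and every lattice edge from B to Bᶜ
closed, then θ(p) = 0. Proof: uniqueness (Grimmett1999_numInfiniteClusters_le_one_holds) + shift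
invariance (bondPercolation_real_preimage_shift): M = sup{t : t·e₀ in an infinite cluster} satisfies
law(M) = law(M+1) on ℤ∪{±∞}, so M ∉ ℤ a.s.; on {0 ↔ ∞} the cap through 0 contains the unique
infinite cluster, forcing 0 ≤ M < ∞. Card item T1. [difficulty: provable-now] -/
@[route_item "route-CriticalPhenomena-PercCriticalCaps"]
def CapLemma : Prop :=
  ∀ (d : ℕ) [NeZero d] (p : unitInterval), (∀ᵐ ω ∂(Literature.Probability.Percolation.bondPercolation (Literature.Probability.LatticeModels.zdGraph d) p), ∃ B : Set (Literature.Probability.LatticeModels.Site d), {x | x 0 ≤ 0} ⊆ B ∧ (∀ x : Literature.Probability.LatticeModels.Site d, BddAbove {t : ℤ | Function.update x 0 t ∈ B}) ∧ ∀ x ∈ B, ∀ y ∉ B, (Literature.Probability.LatticeModels.zdGraph d).Adj x y → s(x, y) ∉ ω) → Literature.Probability.Percolation.theta (Literature.Probability.LatticeModels.zdGraph d) 0 p = 0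

-- `CapLemma` holds: proved by `Summit.CriticalPhenomena.PercolationContinuityZ3.Theorems.PercCriticalCapsCapLemma.capLemma_proof` @ a6ae0b31789a (its module imports this route file, so no `_holds` link can be stated here).

/-- item stmt-CriticalPhenomena-7513 · support · rank 9 · closed · proved by Summit.CriticalPhenomena.PercolationContinuityZ3.Theorems.PercCriticalCapsEnvelopeCap.envelopeCap_proof @ a6ae0b31789a (prover) · by planner
sources: BarskyGrimmettNewman1991, GrimmettPercolation1999
[support] the Barsky–Grimmett–Newman ENVELOPE is a cap: if a.s. the positive axis meets the plane
cluster finitely often, then a.s. B = {x₀ ≤ 0} ∪ {x : x₀ > 0, x ↔ plane} satisfies the three cap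
conditions (horizontal shift invariance gives every column, countably many; an open edge leaving B
would extend a plane connection — contradiction). Pure combinatorics + measure-preserving shifts.
[difficulty: provable-now] -/
@[route_item "route-CriticalPhenomena-PercCriticalCaps"]
def EnvelopeCap : Prop :=
  ∀ (d : ℕ) [NeZero d] (p : unitInterval), (∀ᵐ ω ∂(Literature.Probability.Percolation.bondPercolation (Literature.Probability.LatticeModels.zdGraph d) p), Set.Finite {t : ℤ | 0 < t ∧ ∃ y : Literature.Probability.LatticeModels.Site d, y 0 = 0 ∧ ω ∈ Literature.Probability.Percolation.openConn (Pi.single 0 t : Literature.Probability.LatticeModels.Site d) y}) → ∀ᵐ ω ∂(Literature.Probability.Percolation.bondPercolation (Literature.Probability.LatticeModels.zdGraph d) p), ∃ B : Set (Literature.Probability.LatticeModels.Site d), {x | x 0 ≤ 0} ⊆ B ∧ (∀ x : Literature.Probability.LatticeModels.Site d, BddAbove {t : ℤ | Function.update x 0 t ∈ B}) ∧ ∀ x ∈ B, ∀ y ∉ B, (Literature.Probability.LatticeModels.zdGraph d).Adj x y → s(x, y) ∉ ω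

-- `EnvelopeCap` holds: proved by `Summit.CriticalPhenomena.PercolationContinuityZ3.Theorems.PercCriticalCapsEnvelopeCap.envelopeCap_proof` @ a6ae0b31789a (its module imports this route file, so no `_holds` link can be stated here).

/-- item stmt-CriticalPhenomena-7514 · support · rank 9 · closed · proved by Summit.CriticalPhenomena.PercolationContinuityZ3.Theorems.PercCriticalCapsCapBelowCritical.capBelowCritical_proof @ ed3483399636 (prover) · by planner
sources: AizenmanChayesChayesFrohlichRusso1983, DuminilCopinTassionCMP2016, AizenmanBarsky1987
[support] caps exist strictly below p_c (Aizenman–Chayes–Chayes–Fröhlich–Russo 1983, Lemma 3.1, with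
π_c = p_c): for p < p_c(ℤ^d), a.s. finitely many axis–plane hits, since E#hits ≤ Σ_t Σ_{y₀=0}
τ_p(t·e₀, y) = Σ_{x₀<0} τ_p(0,x) ≤ E_p|C(0)| < ∞ by the PROVED sharpness
DCTQ.summable_real_openConn_of_lt_criticalProb (first moment / Borel–Cantelli). With CapLemma: the
cap threshold equals p_c exactly. [difficulty: provable-now] -/
@[route_item "route-CriticalPhenomena-PercCriticalCaps"]
def CapBelowCritical : Prop :=
  ∀ (d : ℕ) [NeZero d] (p : unitInterval), (p : ℝ) < Literature.Probability.Percolation.criticalProb (Literature.Probability.LatticeModels.zdGraph d) 0 → ∀ᵐ ω ∂(Literature.Probability.Percolation.bondPercolation (Literature.Probability.LatticeModels.zdGraph d) p), Set.Finite {t : ℤ | 0 < t ∧ ∃ y : Literature.Probability.LatticeModels.Site d, y 0 = 0 ∧ ω ∈ Literature.Probability.Percolation.openConn (Pi.single 0 t : Literature.Probability.LatticeModels.Site d) y}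

-- `CapBelowCritical` holds: proved by `Summit.CriticalPhenomena.PercolationContinuityZ3.Theorems.PercCriticalCapsCapBelowCritical.capBelowCritical_proof` @ ed3483399636 (its module imports this route file, so no `_holds` link can be stated here).

/-- item stmt-CriticalPhenomena-7515 · support · rank 9 · closed · proved by Summit.CriticalPhenomena.PercolationContinuityZ3.Theorems.PercCriticalCapsSummableOneArmGivesCap.summableOneArmGivesCap_proof @ a6ae0b31789a (prover) · by planner
sources: KozmaNachmias2011, HeydenreichVanDerHofstad2017, FitznerVanDerHofstad2017, Kesten1982, vandenBergKestenJAP1985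
[support] calibration: if the one-arm probabilities π_p(n) = P_p(0 ↔ ∂B(n)) (siteToBoundary, =
oneArmProb d p n) are summable in n then a.s. finitely many axis–plane hits ({t·e₀ ↔ plane} forces
the one-arm event to distance t−1 around t·e₀; shift invariance; Borel–Cantelli). With
Kozma–Nachmias (π_(p_c)(n) ≤ C/n² for d > 6 under TwoPointBoundedRatio, d ≥ 11 via Hara) caps EXIST
at criticality in high dimensions; contrapositively NoCapAtCriticality needs Σ_n π_(p_c)(n) = ∞ on
ℤ³. [difficulty: provable-now] -/
@[route_item "route-CriticalPhenomena-PercCriticalCaps"]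
def SummableOneArmGivesCap : Prop :=
  ∀ (d : ℕ) [NeZero d] (p : unitInterval), Summable (fun n : ℕ => (Literature.Probability.Percolation.bondPercolation (Literature.Probability.LatticeModels.zdGraph d) p).real (Literature.Probability.Percolation.siteToBoundary d n)) → ∀ᵐ ω ∂(Literature.Probability.Percolation.bondPercolation (Literature.Probability.LatticeModels.zdGraph d) p), Set.Finite {t : ℤ | 0 < t ∧ ∃ y : Literature.Probability.LatticeModels.Site d, y 0 = 0 ∧ ω ∈ Literature.Probability.Percolation.openConn (Pi.single 0 t : Literature.Probability.LatticeModels.Site d) y}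

-- `SummableOneArmGivesCap` holds: proved by `Summit.CriticalPhenomena.PercolationContinuityZ3.Theorems.PercCriticalCapsSummableOneArmGivesCap.summableOneArmGivesCap_proof` @ a6ae0b31789a (its module imports this route file, so no `_holds` link can be stated here).

/-- item stmt-CriticalPhenomena-7516 · support · rank 9 · closed · proved by Summit.CriticalPhenomena.PercolationContinuityZ3.Theorems.PercCriticalCapsCapZeroOne.capZeroOne_proof @ a6ae0b31789a (prover) · by planner
sources: GrimmettPercolation1999, NewmanSchulman1981
[support] zero–one law for caps: P_p(finitely many axis–plane hits) ∈ {0, 1} for every d, p — the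
event "infinitely many hits" is a.s. invariant under the shift by −e₀ (a hit at height t ≥ 2 becomes
a hit at height t−1, the path crossing the new plane), and the shift is ergodic (PROVED
ergodic_relabel_shift_bondPercolation; Mathlib Ergodic.ae_empty_or_univ_of_ae_le_preimage). Makes
NoCapAtCriticality ⇔ ¬CapAtCriticality and lets a refuter kill CAP(p_c) by showing P(infinitely many
hits) > 0. [difficulty: provable-now] -/
@[route_item "route-CriticalPhenomena-PercCriticalCaps"]
def CapZeroOne : Prop :=
  ∀ (d : ℕ) [NeZero d] (p : unitInterval), Literature.Probability.Percolation.bondPercolation (Literature.Probability.LatticeModels.zdGraph d) p {ω | Set.Finite {t : ℤ | 0 < t ∧ ∃ y : Literature.Probability.LatticeModels.Site d, y 0 = 0 ∧ ω ∈ Literature.Probability.Percolation.openConn (Pi.single 0 t : Literature.Probability.LatticeModels.Site d) y}} = 0 ∨ Literature.Probability.Percolation.bondPercolation (Literature.Probability.LatticeModels.zdGraph d) p {ω | Set.Finite {t : ℤ | 0 < t ∧ ∃ y : Literature.Probability.LatticeModels.Site d, y 0 = 0 ∧ ω ∈ Literature.Probability.Percolation.openConn (Pi.single 0 t : Literature.Probability.LatticeModels.Site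 d) y}} = 1

-- `CapZeroOne` holds: proved by `Summit.CriticalPhenomena.PercolationContinuityZ3.Theorems.PercCriticalCapsCapZeroOne.capZeroOne_proof` @ a6ae0b31789a (its module imports this route file, so no `_holds` link can be stated here).

/-- item stmt-CriticalPhenomena-7517 · assembly · rank 1 · closed · proved by Summit.CriticalPhenomena.PercolationContinuityZ3.Theorems.PercCriticalCapsAssembly.assembly_proof @ 33706488ffa0 (prover) · by planner
sources: AizenmanChayesChayesFrohlichRusso1983, GrimmettPercolation1999
[assembly] CapLemma → EnvelopeCap → CapAtCriticality → θ_(ℤ³)(p_c) = 0 (the conjunct), by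
instantiating d = 3, p = p_c. -/
@[route_item "route-CriticalPhenomena-PercCriticalCaps"]
def Assembly : Prop :=
  CapLemma → EnvelopeCap → CapAtCriticality → PercolationContinuityZ3

-- `Assembly` holds: proved by `Summit.CriticalPhenomena.PercolationContinuityZ3.Theorems.PercCriticalCapsAssembly.assembly_proof` @ 33706488ffa0 (its module imports this route file, so no `_holds` link can be stated here).

/-! D-0027 §2.1 — DECIDING THEOREM (planner-authored via `route open/edit --closes-file`; by planner-rrepair-CriticalPhenomena-PercCritical-65bccb08-g2-0 2026-08-15T16:54:58Z):
its hypotheses are this route's items and its conclusion the sub-problem Statement (glue_lint), and it elaborates with this file. -/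

@[closes "route-CriticalPhenomena-PercCriticalCaps"] theorem closes (hL : CapLemma) (hE : EnvelopeCap) (hC : CapAtCriticality) : _root_.PercolationContinuityZ3 := hL 3 _ (hE 3 _ hC)

end Summit.CriticalPhenomena.PercolationContinuityZ3.Theses.PercCriticalCaps
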